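import Summits.NavierStokesRegularity.FluidComputer.PalasekTowerGermHostTolerant
import Literature.Analysis.FluidPDE.LerayProfileCalculus
import Literature.Analysis.FluidPDE.ParabolicComparison

/-!
# The germ host, XXI: THE ANCHOR TEST IS A PRESSURE TEST (general profile, no symmetry)

Cell `ns-blowup`, seat `ns-blowup-ecbridge-3` (g4); GROUP C «BRIDGE SUPPORT» of the route
`PalasekTowerBreakdown` (crux `EpisodeBaseG`, item stmt-NavierStokesRegularity-19179, R2 of record;
registered line `slot`, ONE stub over the STRICT slot `Germ.LevelZeroData`). LABEL: E–C typing
(KERNEL calculus: identities and inequalities at a speed maximum, no definition). WHAT THIS IS NOT: not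
Navier–Stokes evidence — first-order calculus of the NS acceleration of a PRESCRIBED profile at one
instant; nothing about any flow after `τ₀`, `FirstEpisodeD`, `RungG 1` or blow-up.

## What and why

Every slot of record asks, at each speed maximum `x₀` of the profile `U` (`‖U x₀‖ = Y₀ = sup ‖U‖`),
a sign of the first-order anchor value `⟪U(x₀), V(x₀)⟫`, `V = P(νΔU − (U·∇)U) = νΔU − (U·∇)U − ∇π[U]`
(`= ½ ∂ₜ‖u‖²(τ₀, x₀)` along the free flow through `U`). GermHost VI computed it for EVEN carriers
(`IsEvenAbout.inner_accel_center`: `= ν⟪U, ΔU⟫(x₀)`, so a symmetric carrier alone fails). Here the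
general profile, by the calculus of a maximum of `‖U‖²`:

* §1 at a local maximum `x₀` of `‖U‖`: **`inner_convect_self_eq_zero_of_isLocalMax`**
  (`⟪U, (U·∇)U⟫(x₀) = ½ ∂_{U}‖U‖²(x₀) = 0` — transport never moves the speed maximum at first order) and
  **`inner_laplacian_add_frobeniusNormSq_nonpos_of_isLocalMax`**
  (`⟪U, ΔU⟫(x₀) + |∇U(x₀)|² = ½ Δ‖U‖²(x₀) ≤ 0` — viscosity brakes it by at least the local dissipation
  density `|∇U(x₀)|²`, the tree's `laplacian_inner_self_eq` + `IsLocalMax.laplacian_nonpos`);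
* §2 hence **`inner_accel_eq_of_isLocalMax`**: `⟪U, V⟫(x₀) = ν⟪U, ΔU⟫(x₀) − ⟪U(x₀), ∇π[U](x₀)⟫` and
  **`inner_accel_le_of_isLocalMax`**: `⟪U, V⟫(x₀) ≤ −⟪U(x₀), ∇π[U](x₀)⟫ − ν |∇U(x₀)|²` (`ν ≥ 0`) —
  ONLY THE PRESSURE CAN RAISE THE SPEED MAXIMUM, and it must beat the local dissipation;
* §3 the necessary condition this puts on every filler of the three slots (`ν = 1`): STRICT ⇒
  `|∇U(x₀)|² < ⟪U(x₀), −∇π[U](x₀)⟫` (`LevelZeroData.frobeniusNormSq_lt_pressurePush`), WEAK ⇒ `≤`,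
  TOLERANT ⇒ `< … + c₄Y₀²/8`; and the converse reading `anchor_test_iff_pressure` (the strict test at a
  speed maximum ⟺ `−ν⟪U, ΔU⟫(x₀) < ⟪U(x₀), −∇π[U](x₀)⟫`), the exact target a design's certified
  Poisson evaluation must hit (holder census 19179 §3), with the far part of `π` priced by XVIII.

References: T.-P. Tsai, ARMA 143 (1998), proof of Lemma 3.1 (`Δ|U|² = 2U·ΔU + 2|∇U|²`)
[cite: Tsai1998, proof of Lemma 3.1 (p. 37)]; G. M. Lieberman, *Second Order Parabolic Differential
Equations* (1996), Ch. II Lemma 2.1 (second-order condition at a maximum) [cite: Lieberman1996, Ch. II Lemma 2.1 (proof)];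
A. J. Majda, A. L. Bertozzi, *Vorticity and Incompressible Flow* (CUP 2002), §1.8 Prop. 1.16
[cite: MajdaBertozziCUP2002, §1.8 Prop. 1.16].
-/

noncomputable section

namespace Summit.NavierStokesRegularity.FluidComputer.PalasekTowerClayBridge.Germ

open Set Function Filter Topology InnerProductSpace Metric
open scoped Topology ContDiff RealInnerProductSpace Laplacian

open Literature.Analysis.FluidPDE

variable {U : EuclideanSpace ℝ (Fin 3) → EuclideanSpace ℝ (Fin 3)} {x₀ : EuclideanSpace ℝ (Fin 3)}

/-! ## §1 First- and second-order conditions at a speed maximum -/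

/-- A local maximum of `‖U‖` is a local maximum of `⟪U, U⟫`. [folklore] -/
theorem isLocalMax_inner_self_of_isLocalMax_norm (hmax : IsLocalMax (fun y => ‖U y‖) x₀) :
    IsLocalMax (fun y => ⟪U y, U y⟫) x₀ :=
  Filter.Eventually.mono hmax fun y hy => by
    simp only [real_inner_self_eq_norm_sq]
    exact pow_le_pow_left₀ (norm_nonneg _) hy 2

/-- A global speed maximum (`‖U x₀‖ = Y` with `‖U‖ ≤ Y` everywhere) is a local maximum of `‖U‖`.
[folklore] -/
theorem isLocalMax_norm_of_ceiling {Y : ℝ} (hceil : ∀ y, ‖U y‖ ≤ Y) (hx₀ : ‖U x₀‖ = Y) :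
    IsLocalMax (fun y => ‖U y‖) x₀ :=
  Filter.Eventually.of_forall fun y => by
    show ‖U y‖ ≤ ‖U x₀‖
    rw [hx₀]; exact hceil y

/-- **Transport never moves the speed maximum at first order**: at a local maximum `x₀` of `‖U‖`,
`⟪U(x₀), DU(x₀) v⟫ = 0` for every direction `v` (`D‖U‖²(x₀) = 0`). [folklore] -/
theorem inner_fderiv_apply_eq_zero_of_isLocalMax (hU : ContDiff ℝ 1 U)
    (hmax : IsLocalMax (fun y => ‖U y‖) x₀) (v : EuclideanSpace ℝ (Fin 3)) :
    ⟪U x₀, fderiv ℝ U x₀ v⟫ = 0 := by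
  have hd : DifferentiableAt ℝ U x₀ := (hU.differentiable (by simp)) x₀
  have h0 := (isLocalMax_inner_self_of_isLocalMax_norm hmax).fderiv_eq_zero
  have h1 : fderiv ℝ (fun y => ⟪U y, U y⟫) x₀ v = 0 := by rw [h0]; rfl
  rw [fderiv_inner_apply ℝ hd hd v, real_inner_comm (U x₀) (fderiv ℝ U x₀ v)] at h1
  linarith

/-- … in particular `⟪U(x₀), (U·∇)U(x₀)⟫ = 0`. [folklore] -/
theorem inner_convect_self_eq_zero_of_isLocalMax (hU : ContDiff ℝ 1 U)
    (hmax : IsLocalMax (fun y => ‖U y‖) x₀) : ⟪U x₀, convect U U x₀⟫ = 0 := by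
  rw [convect_apply]
  exact inner_fderiv_apply_eq_zero_of_isLocalMax hU hmax (U x₀)

/-- **Viscosity brakes the speed maximum by at least the local dissipation**: at a local maximum `x₀`
of `‖U‖`, `⟪U(x₀), ΔU(x₀)⟫ + |∇U(x₀)|² ≤ 0` (`½Δ‖U‖² = ⟪U, ΔU⟫ + |∇U|² ≤ 0` there).
[cite: Tsai1998, proof of Lemma 3.1 (p. 37)] -/
theorem inner_laplacian_add_frobeniusNormSq_nonpos_of_isLocalMax (hU : ContDiff ℝ 2 U)
    (hmax : IsLocalMax (fun y => ‖U y‖) x₀) :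
    ⟪U x₀, (Δ U) x₀⟫ + frobeniusNormSq (fderiv ℝ U x₀) ≤ 0 := by
  have hmax2 := isLocalMax_inner_self_of_isLocalMax_norm hmax
  have hΔ := hmax2.laplacian_nonpos (hU.inner ℝ hU)
  rw [laplacian_inner_self_eq hU x₀, real_inner_comm] at hΔ
  linarith

/-- … so `⟪U(x₀), ΔU(x₀)⟫ ≤ −|∇U(x₀)|² ≤ 0`. [cite: Lieberman1996, Ch. II Lemma 2.1 (proof)] -/
theorem inner_laplacian_nonpos_of_isLocalMax (hU : ContDiff ℝ 2 U)
    (hmax : IsLocalMax (fun y => ‖U y‖) x₀) : ⟪U x₀, (Δ U) x₀⟫ ≤ 0 := by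
  have h := inner_laplacian_add_frobeniusNormSq_nonpos_of_isLocalMax hU hmax
  linarith [frobeniusNormSq_nonneg (fderiv ℝ U x₀)]

/-! ## §2 The anchor value at a speed maximum: pressure push minus viscous brake -/

/-- **`⟪U, V⟫(x₀) = ν⟪U, ΔU⟫(x₀) − ⟪U(x₀), ∇π[U](x₀)⟫`** at a local maximum of `‖U‖` (Helmholtz
`V = νΔU − (U·∇)U − ∇π` and §1). [cite: MajdaBertozziCUP2002, §1.8 Prop. 1.16] -/
theorem inner_accel_eq_of_isLocalMax (hU : ContDiff ℝ ∞ U) (hmax : IsLocalMax (fun y => ‖U y‖) x₀)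
    (ν : ℝ) : ⟪U x₀, accel ν U x₀⟫ = ν * ⟪U x₀, (Δ U) x₀⟫ - ⟪U x₀, gradient (pot ν U) x₀⟫ := by
  rw [accel_apply, drift, inner_sub_right, inner_sub_right, real_inner_smul_right,
    inner_convect_self_eq_zero_of_isLocalMax (hU.of_le (by norm_cast)) hmax, sub_zero]

/-- **ONLY THE PRESSURE CAN RAISE THE SPEED MAXIMUM**: at a local maximum of `‖U‖` and for `ν ≥ 0`,
`⟪U, V⟫(x₀) ≤ −⟪U(x₀), ∇π[U](x₀)⟫ − ν |∇U(x₀)|²`. [cite: Tsai1998, proof of Lemma 3.1 (p. 37)] -/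
theorem inner_accel_le_of_isLocalMax (hU : ContDiff ℝ ∞ U) (hmax : IsLocalMax (fun y => ‖U y‖) x₀)
    {ν : ℝ} (hν : 0 ≤ ν) :
    ⟪U x₀, accel ν U x₀⟫ ≤
      -⟪U x₀, gradient (pot ν U) x₀⟫ - ν * frobeniusNormSq (fderiv ℝ U x₀) := by
  rw [inner_accel_eq_of_isLocalMax hU hmax ν]
  have h := inner_laplacian_add_frobeniusNormSq_nonpos_of_isLocalMax (hU.of_le (by norm_cast)) hmax
  nlinarith

/-- **The strict anchor test at a speed maximum is a pressure inequality**: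
`0 < ⟪U, V⟫(x₀) ⟺ −ν⟪U, ΔU⟫(x₀) < ⟪U(x₀), −∇π[U](x₀)⟫` (left side `≥ ν|∇U(x₀)|² ≥ 0`).
[cite: MajdaBertozziCUP2002, §1.8 Prop. 1.16] -/
theorem anchor_test_iff_pressure (hU : ContDiff ℝ ∞ U) (hmax : IsLocalMax (fun y => ‖U y‖) x₀)
    (ν : ℝ) :
    0 < ⟪U x₀, accel ν U x₀⟫ ↔ -(ν * ⟪U x₀, (Δ U) x₀⟫) < -⟪U x₀, gradient (pot ν U) x₀⟫ := by
  rw [inner_accel_eq_of_isLocalMax hU hmax ν]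
  constructor <;> intro h <;> linarith

/-! ## §3 What every slot filler's self-pressure does at its argmax (`ν = 1`) -/

/-- **STRICT slot ⇒ the self-pressure push beats the local dissipation**: for `h : LevelZeroData U ρ`
and every argmax point `x₀`, `|∇U(x₀)|² < ⟪U(x₀), −∇π[U](x₀)⟫`. [cite: Tsai1998, proof of Lemma 3.1 (p. 37)] -/
theorem LevelZeroData.frobeniusNormSq_lt_pressurePush {ρ : ℝ} (h : LevelZeroData U ρ)
    (hx₀ : ‖U x₀‖ = TowerRates.wide.Y 0) :
    frobeniusNormSq (fderiv ℝ U x₀) < -⟪U x₀, gradient (pot 1 U) x₀⟫ := by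
  have hmax := isLocalMax_norm_of_ceiling h.ceiling hx₀
  have h1 := h.anchor x₀ hx₀
  have h2 := inner_accel_le_of_isLocalMax h.smooth hmax zero_le_one
  linarith

/-- **WEAK slot ⇒** `|∇U(x₀)|² ≤ ⟪U(x₀), −∇π[U](x₀)⟫` at every argmax point.
[cite: Tsai1998, proof of Lemma 3.1 (p. 37)] -/
theorem LevelZeroDataWeak.frobeniusNormSq_le_pressurePush {ρ : ℝ} (h : LevelZeroDataWeak U ρ)
    (hx₀ : ‖U x₀‖ = TowerRates.wide.Y 0) :
    frobeniusNormSq (fderiv ℝ U x₀) ≤ -⟪U x₀, gradient (pot 1 U) x₀⟫ := by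
  have hmax := isLocalMax_norm_of_ceiling h.ceiling hx₀
  have h1 := h.anchor x₀ hx₀
  have h2 := inner_accel_le_of_isLocalMax h.smooth hmax zero_le_one
  linarith

/-- **TOLERANT slot ⇒** `|∇U(x₀)|² < ⟪U(x₀), −∇π[U](x₀)⟫ + c₄Y₀²/8` at every argmax point: the push
budget of the register pays for at most `c₄Y₀²/8` of unbalanced dissipation at the speed maximum.
[cite: Tsai1998, proof of Lemma 3.1 (p. 37)] -/
theorem LevelZeroDataTol.frobeniusNormSq_lt_pressurePush {c₄ ρ : ℝ} (h : LevelZeroDataTol c₄ U ρ)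
    (hx₀ : ‖U x₀‖ = TowerRates.wide.Y 0) :
    frobeniusNormSq (fderiv ℝ U x₀) <
      -⟪U x₀, gradient (pot 1 U) x₀⟫ + c₄ * TowerRates.wide.Y 0 ^ 2 / 8 := by
  have hmax := isLocalMax_norm_of_ceiling h.ceiling hx₀
  have h1 := h.anchor x₀ hx₀
  have h2 := inner_accel_le_of_isLocalMax h.smooth hmax zero_le_one
  linarith

/-- **Sufficient form for typists**: a profile with the slot's ceiling whose self-pressure push at every
argmax point beats its viscous brake there, `−⟪U, ΔU⟫(x₀) < ⟪U(x₀), −∇π[U](x₀)⟫`, passes the STRICT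
test at every argmax point (`ν = 1`). [cite: MajdaBertozziCUP2002, §1.8 Prop. 1.16] -/
theorem anchor_of_pressurePush (hU : ContDiff ℝ ∞ U) {Y : ℝ} (hceil : ∀ y, ‖U y‖ ≤ Y)
    (hpush : ∀ x, ‖U x‖ = Y → -⟪U x, (Δ U) x⟫ < -⟪U x, gradient (pot 1 U) x⟫) :
    ∀ x, ‖U x‖ = Y → 0 < ⟪U x, accel 1 U x⟫ := fun x hx => by
  rw [anchor_test_iff_pressure hU (isLocalMax_norm_of_ceiling hceil hx) 1, one_mul]
  exact hpush x hx

end Summit.NavierStokesRegularity.FluidComputer.PalasekTowerClayBridge.Germ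

end
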